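import Literature.Computability.MetaComplexity.LevelledRefutationCNFFill
import HarnessLib

/-!
# Garlík's random restriction for `REF^F_{s,t}`: the restriction as a function of the sample

Support file for the proof of `levelledRefCNF_lowerBound` ([Garlík 2019, Thm 1]); first part of
the probabilistic half of [Garlík 2019, §4]. We define the sample space `Ω P` of the random
restriction of [Garlík 2019, Def. 9] and the restriction `rho P Fc K₀ ω : PA` determined by a
sample `ω`, and prove that it is always *admissible* ([Garlík 2019, Def. 15]; this replaces
[Garlík 2019, Lemma 17]) and, when the selection counts are at most `K₀` per level, `6K₀`-sparse
per level ([Garlík 2019, Lemma 10]). The probability estimates are in the companion file.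

## The sample and the restriction (deviations from [Garlík 2019, Def. 9])

A sample consists of four independent blocks: for every pair `(i,j)` a `D`-selection bit and a
sign vector (the random full clause), a `V`-selection bit and a variable index, for every
position `j` an `I`-selection bit and a clause index, and for every pair an `RL`-selection bit
and two candidate children `cL, cR` (positions of the previous level). Instead of a uniformly
random injection `h_i` we let every selected pair propose i.i.d. uniform children and keep,
greedily in the order of `j`, the selected pairs whose two proposals are fresh (`surv`); if more
than `K₀` pairs of a level are selected, the level keeps nothing (`S`). A kept pair that is
itself a child of a kept pair of the next level is dropped (`Kp = S ∖ B`), so the forest of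
[Garlík 2019, Def. 11] has depth one. At kept pairs and at their children the clause, cut
variable and `F`-clause index are *forced* (the all-negative clause `C*`, cut variable `x_0`,
children `C*[x_0 ↦ 1]` and `C*`, and an `F`-clause contained in the clause, which exists by
unsatisfiability), the last pair `(s-1,t-1)` is never touched, a `V`-selection takes priority
over the cut variable forced by a `D`-selection, and on level `0` an `I`-selection cancels a
`D`-selection. With these conventions the restriction is admissible for *every* sample, so
[Garlík 2019, Lemma 12] (forbidden patterns) is not needed, and the case analysis of
[Garlík 2019, Lemma 17] disappears (it also sidesteps a gap in case 2 of that proof, where a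
child clause fixed by `ρ` need not contain the cut literal required by (C7)).

## References

* M. Garlík, *Resolution lower bounds for refutation statements*, MFCS 2019 / arXiv:1905.12372,
  §4, Def. 9, Lemma 10, Def. 11, Lemma 17.
-/

namespace Literature.Computability.MetaComplexity

open _root_.Computability Complexity

namespace LevelledRefCNF

/-! ### The sample space -/

/-- The `D`-block of a sample: for every pair a selection bit and a sign vector.
[cite: Garlik2019, Def. 9 (first item)] -/
abbrev ΩD (P : Params) : Type := Fin P.s × Fin P.t → Bool × (Fin P.n → Bool)

/-- The `V`-block of a sample: for every pair a selection bit and a variable index.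
[cite: Garlik2019, Def. 9 (third item)] -/
abbrev ΩV (P : Params) : Type := Fin P.s × Fin P.t → Bool × Fin P.n

/-- The `I`-block of a sample: for every position a selection bit and a clause index.
[cite: Garlik2019, Def. 9 (second item)] -/
abbrev ΩI (P : Params) : Type := Fin P.t → Bool × Fin P.r

/-- The `RL`-block of a sample, level by level: for every position a selection bit and two
candidate children. [cite: Garlik2019, Def. 9 (fourth item)] -/
abbrev ΩRL (P : Params) : Type := Fin P.s → Fin P.t → Bool × (Fin P.t × Fin P.t)

/-- The sample space of the random restriction: four independent blocks.
[cite: Garlik2019, Def. 9] -/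
abbrev Ω (P : Params) : Type := ((ΩD P × ΩV P) × ΩI P) × ΩRL P

section Accessors

variable (P : Params)

/-- `D`-selection bit of the pair `(i,j)` (false out of range). [cite: Garlik2019, Def. 9] -/
def selD (d : ΩD P) (i j : ℕ) : Bool :=
  if h : i < P.s ∧ j < P.t then (d (⟨i, h.1⟩, ⟨j, h.2⟩)).1 else false

/-- The sign vector of the pair `(i,j)` (the random full clause). [cite: Garlik2019, Def. 9] -/
def signs (d : ΩD P) (i j : ℕ) (ℓ : ℕ) : Bool :=
  if h : i < P.s ∧ j < P.t ∧ ℓ < P.n then (d (⟨i, h.1⟩, ⟨j, h.2.1⟩)).2 ⟨ℓ, h.2.2⟩ else false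

/-- `V`-selection bit of the pair `(i,j)`. [cite: Garlik2019, Def. 9] -/
def selV (v : ΩV P) (i j : ℕ) : Bool :=
  if h : i < P.s ∧ j < P.t then (v (⟨i, h.1⟩, ⟨j, h.2⟩)).1 else false

/-- The proposed cut variable of the pair `(i,j)`. [cite: Garlik2019, Def. 9] -/
def valV (v : ΩV P) (i j : ℕ) : ℕ :=
  if h : i < P.s ∧ j < P.t then ((v (⟨i, h.1⟩, ⟨j, h.2⟩)).2 : ℕ) else 0

/-- `I`-selection bit of the position `j`. [cite: Garlik2019, Def. 9] -/
def selI (e : ΩI P) (j : ℕ) : Bool :=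
  if h : j < P.t then (e ⟨j, h⟩).1 else false

/-- The proposed clause index of the position `j`. [cite: Garlik2019, Def. 9] -/
def valI (e : ΩI P) (j : ℕ) : ℕ :=
  if h : j < P.t then ((e ⟨j, h⟩).2 : ℕ) else 0

/-- `RL`-selection bit of the pair `(i,j)`: only on levels `1 ≤ i < s`, and never at the last
pair `(s-1, t-1)`. [cite: Garlik2019, Def. 9] -/
def selRL (g : ΩRL P) (i j : ℕ) : Bool :=
  if h : 1 ≤ i ∧ i < P.s ∧ j < P.t ∧ ¬ (i + 1 = P.s ∧ j + 1 = P.t) then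
    (g ⟨i, h.2.1⟩ ⟨j, h.2.2.1⟩).1 else false

/-- The proposed left child of the pair `(i,j)` (a position of level `i-1`).
[cite: Garlik2019, Def. 9] -/
def cL (g : ΩRL P) (i j : ℕ) : ℕ :=
  if h : i < P.s ∧ j < P.t then ((g ⟨i, h.1⟩ ⟨j, h.2⟩).2.1 : ℕ) else 0

/-- The proposed right child of the pair `(i,j)`. [cite: Garlik2019, Def. 9] -/
def cR (g : ΩRL P) (i j : ℕ) : ℕ :=
  if h : i < P.s ∧ j < P.t then ((g ⟨i, h.1⟩ ⟨j, h.2⟩).2.2 : ℕ) else 0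

/-- The last pair `(s-1, t-1)`. [cite: Garlik2019, §3 (the clause C_{s,t})] -/
def IsLast (i j : ℕ) : Prop := i + 1 = P.s ∧ j + 1 = P.t

/-- Decidability instance. [folklore] -/
instance (i j : ℕ) : Decidable (IsLast P i j) := inferInstanceAs (Decidable (_ ∧ _))

end Accessors

/-! ### The greedy injection and the forest -/

section Forest

variable (P : Params)

/-- The children proposed by the selected pairs of level `i` before position `j`.
[cite: Garlik2019, Lemma 14 (proof of (iv): the sequential construction of h_i)] -/
def usedBefore (g : ΩRL P) (i j : ℕ) : Finset ℕ :=
  ((Finset.range j).filter fun j' => selRL P g i j' = true).biUnion fun j' => {cL P g i j', cR P g i j'}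

/-- A selected pair *survives* if its two proposed children are fresh and distinct (the greedy
construction of an injection). [cite: Garlik2019, Def. 9 (the injection h_i)] -/
def Surv (g : ΩRL P) (i j : ℕ) : Prop :=
  selRL P g i j = true ∧ cL P g i j ∉ usedBefore P g i j ∧ cR P g i j ∉ usedBefore P g i j ∧
    cL P g i j ≠ cR P g i j

/-- Decidability instance. [folklore] -/
instance (g : ΩRL P) (i j : ℕ) : Decidable (Surv P g i j) :=
  inferInstanceAs (Decidable (_ ∧ _))

/-- The selected pairs of level `i` (the set `A_i`). [cite: Garlik2019, Def. 9 (A_i)] -/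
def selSet (g : ΩRL P) (i : ℕ) : Finset ℕ :=
  (Finset.range P.t).filter fun j => selRL P g i j = true

/-- The kept pairs of level `i` before removing children (empty if more than `K₀` pairs are
selected). [cite: Garlik2019, Def. 9 ("If |A_i| > 2pt, define h_i := ∅")] -/
def S (K₀ : ℕ) (g : ΩRL P) (i : ℕ) : Finset ℕ :=
  if K₀ < (selSet P g i).card then ∅ else (Finset.range P.t).filter fun j => Surv P g i j

/-- The children on level `i` (the set `B_i`). [cite: Garlik2019, Def. 9 (B_{i-1})] -/
def B (K₀ : ℕ) (g : ΩRL P) (i : ℕ) : Finset ℕ :=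
  (S P K₀ g (i + 1)).biUnion fun j => {cL P g (i + 1) j, cR P g (i + 1) j}

/-- The kept pairs of level `i`: survivors that are not themselves children.
[cite: Garlik2019, Def. 11 (the forest G_ρ; here of depth one)] -/
def Kp (K₀ : ℕ) (g : ΩRL P) (i : ℕ) : Finset ℕ :=
  S P K₀ g i \ B P K₀ g i

/-- `(i,j)` is the left child of a kept pair of level `i+1`. [cite: Garlik2019, Def. 11] -/
def IsLeftChild (K₀ : ℕ) (g : ΩRL P) (i j : ℕ) : Prop :=
  ∃ j₂ ∈ S P K₀ g (i + 1), cL P g (i + 1) j₂ = j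

variable {P}

/-- Selection implies the level is `≥ 1`, in range, and the pair is not the last.
[folklore] -/
theorem selRL_spec {g : ΩRL P} {i j : ℕ} (h : selRL P g i j = true) :
    1 ≤ i ∧ i < P.s ∧ j < P.t ∧ ¬ IsLast P i j := by
  unfold selRL at h
  split_ifs at h with hc
  exact hc

/-- Proposed children are positions. [folklore] -/
theorem cL_lt {g : ΩRL P} {i j : ℕ} (ht : 0 < P.t) : cL P g i j < P.t := by
  unfold cL; split_ifs
  · exact Fin.is_lt _
  · exact ht

/-- Proposed children are positions. [folklore] -/
theorem cR_lt {g : ΩRL P} {i j : ℕ} (ht : 0 < P.t) : cR P g i j < P.t := by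
  unfold cR; split_ifs
  · exact Fin.is_lt _
  · exact ht

/-- Members of `S` survive. [folklore] -/
theorem surv_of_mem_S {K₀ : ℕ} {g : ΩRL P} {i j : ℕ} (h : j ∈ S P K₀ g i) :
    Surv P g i j ∧ j < P.t ∧ (selSet P g i).card ≤ K₀ := by
  unfold S at h
  split_ifs at h with hc
  · simp at h
  · simp only [Finset.mem_filter, Finset.mem_range] at h
    exact ⟨h.2, h.1, not_lt.1 hc⟩

/-- Members of `S` are selected. [folklore] -/
theorem selRL_of_mem_S {K₀ : ℕ} {g : ΩRL P} {i j : ℕ} (h : j ∈ S P K₀ g i) :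
    selRL P g i j = true :=
  (surv_of_mem_S h).1.1

/-- `S` is contained in the selected set. [folklore] -/
theorem S_subset_selSet (K₀ : ℕ) (g : ΩRL P) (i : ℕ) : S P K₀ g i ⊆ selSet P g i := by
  intro j hj
  simp only [selSet, Finset.mem_filter, Finset.mem_range]
  exact ⟨(surv_of_mem_S hj).2.1, selRL_of_mem_S hj⟩

/-- At most `K₀` pairs are kept per level. [cite: Garlik2019, Lemma 10 (ii)] -/
theorem card_S_le (K₀ : ℕ) (g : ΩRL P) (i : ℕ) : (S P K₀ g i).card ≤ K₀ := by
  by_cases h : (S P K₀ g i).Nonempty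
  · obtain ⟨j, hj⟩ := h
    exact (Finset.card_le_card (S_subset_selSet K₀ g i)).trans (surv_of_mem_S hj).2.2
  · rw [Finset.not_nonempty_iff_eq_empty.1 h]; simp

/-- At most `2K₀` children per level. [cite: Garlik2019, Lemma 10 (ii) (|B_{i-1}| = 2|A_i|)] -/
theorem card_B_le (K₀ : ℕ) (g : ΩRL P) (i : ℕ) : (B P K₀ g i).card ≤ 2 * K₀ := by
  unfold B
  calc ((S P K₀ g (i + 1)).biUnion fun j => {cL P g (i + 1) j, cR P g (i + 1) j}).card
      ≤ ∑ j ∈ S P K₀ g (i + 1), ({cL P g (i + 1) j, cR P g (i + 1) j} : Finset ℕ).card :=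
        Finset.card_biUnion_le
    _ ≤ ∑ _j ∈ S P K₀ g (i + 1), 2 := Finset.sum_le_sum fun j _ => Finset.card_le_two
    _ = 2 * (S P K₀ g (i + 1)).card := by rw [Finset.sum_const, smul_eq_mul, mul_comm]
    _ ≤ 2 * K₀ := Nat.mul_le_mul_left 2 (card_S_le K₀ g (i + 1))

/-- At most `K₀` pairs are kept per level. [folklore] -/
theorem card_Kp_le (K₀ : ℕ) (g : ΩRL P) (i : ℕ) : (Kp P K₀ g i).card ≤ K₀ :=
  (Finset.card_le_card Finset.sdiff_subset).trans (card_S_le K₀ g i)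

/-- A child proposed by an earlier selected pair is used. [folklore] -/
theorem mem_usedBefore {g : ΩRL P} {i j j' : ℕ} (hj' : j' < j) (hsel : selRL P g i j' = true) :
    cL P g i j' ∈ usedBefore P g i j ∧ cR P g i j' ∈ usedBefore P g i j := by
  constructor <;>
  · simp only [usedBefore, Finset.mem_biUnion, Finset.mem_filter, Finset.mem_range,
      Finset.mem_insert, Finset.mem_singleton]
    exact ⟨j', ⟨hj', hsel⟩, by simp⟩

/-- **The greedy construction is an injection**: distinct survivors have disjoint children,
and the two children of a survivor differ. [cite: Garlik2019, Def. 9 (h_i is an injection)] -/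
theorem children_disjoint {K₀ : ℕ} {g : ΩRL P} {i j₁ j₂ : ℕ} (h₁ : j₁ ∈ S P K₀ g i)
    (h₂ : j₂ ∈ S P K₀ g i) (hne : j₁ ≠ j₂) :
    cL P g i j₁ ≠ cL P g i j₂ ∧ cL P g i j₁ ≠ cR P g i j₂ ∧ cR P g i j₁ ≠ cL P g i j₂ ∧
      cR P g i j₁ ≠ cR P g i j₂ := by
  obtain ⟨⟨hs₁, hL₁, hR₁, -⟩, -, -⟩ := surv_of_mem_S h₁
  obtain ⟨⟨hs₂, hL₂, hR₂, -⟩, -, -⟩ := surv_of_mem_S h₂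
  rcases lt_or_gt_of_ne hne with hlt | hlt
  · obtain ⟨huL, huR⟩ := mem_usedBefore hlt hs₁
    exact ⟨fun h => hL₂ (h ▸ huL), fun h => hR₂ (h ▸ huL), fun h => hL₂ (h ▸ huR),
      fun h => hR₂ (h ▸ huR)⟩
  · obtain ⟨huL, huR⟩ := mem_usedBefore hlt hs₂
    exact ⟨fun h => hL₁ (h ▸ huL), fun h => hL₁ (h ▸ huR), fun h => hR₁ (h ▸ huL),
      fun h => hR₁ (h ▸ huR)⟩

/-- The two children of a survivor differ. [folklore] -/
theorem cL_ne_cR {K₀ : ℕ} {g : ΩRL P} {i j : ℕ} (h : j ∈ S P K₀ g i) : cL P g i j ≠ cR P g i j :=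
  (surv_of_mem_S h).1.2.2.2

/-- A right child is not a left child. [folklore] -/
theorem not_isLeftChild_cR {K₀ : ℕ} {g : ΩRL P} {p j : ℕ} (h : j ∈ S P K₀ g (p + 1)) :
    ¬ IsLeftChild P K₀ g p (cR P g (p + 1) j) := by
  rintro ⟨j₂, hj₂, he⟩
  by_cases hjj : j₂ = j
  · subst hjj; exact cL_ne_cR h he
  · exact (children_disjoint hj₂ h hjj).2.1 he

/-- Members of `B` come from a kept pair of the next level. [folklore] -/
theorem mem_B {K₀ : ℕ} {g : ΩRL P} {i k : ℕ} (h : k ∈ B P K₀ g i) :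
    ∃ j ∈ S P K₀ g (i + 1), k = cL P g (i + 1) j ∨ k = cR P g (i + 1) j := by
  simp only [B, Finset.mem_biUnion, Finset.mem_insert, Finset.mem_singleton] at h
  obtain ⟨j, hj, h⟩ := h
  exact ⟨j, hj, h⟩

/-- Children of kept pairs of level `p+1` are in `B p`. [folklore] -/
theorem cL_mem_B {K₀ : ℕ} {g : ΩRL P} {p j : ℕ} (h : j ∈ S P K₀ g (p + 1)) :
    cL P g (p + 1) j ∈ B P K₀ g p := by
  simp only [B, Finset.mem_biUnion, Finset.mem_insert, Finset.mem_singleton]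
  exact ⟨j, h, Or.inl rfl⟩

/-- Children of kept pairs of level `p+1` are in `B p`. [folklore] -/
theorem cR_mem_B {K₀ : ℕ} {g : ΩRL P} {p j : ℕ} (h : j ∈ S P K₀ g (p + 1)) :
    cR P g (p + 1) j ∈ B P K₀ g p := by
  simp only [B, Finset.mem_biUnion, Finset.mem_insert, Finset.mem_singleton]
  exact ⟨j, h, Or.inr rfl⟩

/-- Kept pairs are not children. [folklore] -/
theorem mem_Kp {K₀ : ℕ} {g : ΩRL P} {i j : ℕ} :
    j ∈ Kp P K₀ g i ↔ j ∈ S P K₀ g i ∧ j ∉ B P K₀ g i := by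
  simp [Kp]

/-- The level of a member of `B` is not the top level. [folklore] -/
theorem lt_of_mem_B {K₀ : ℕ} {g : ΩRL P} {i k : ℕ} (h : k ∈ B P K₀ g i) : i + 1 < P.s := by
  obtain ⟨j, hj, -⟩ := mem_B h
  exact (selRL_spec (selRL_of_mem_S hj)).2.1

end Forest

/-! ### Full clauses from sign vectors; the forced `F`-clause index -/

section Clauses

variable (P : Params)

/-- The full clause with sign vector `σ`: `x_ℓ^{σ ℓ}` for `ℓ < n`.
[cite: Garlik2019, Def. 9 (first item: the random clause C_{i,j})] -/
def clauseOf (σ : ℕ → Bool) : Finset (ℕ × Bool) :=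
  (Finset.range P.n).image fun ℓ => (ℓ, σ ℓ)

/-- Membership in `clauseOf`. [folklore] -/
theorem mem_clauseOf {σ : ℕ → Bool} {q : ℕ × Bool} : q ∈ clauseOf P σ ↔ q.1 < P.n ∧ q.2 = σ q.1 := by
  constructor
  · intro h
    obtain ⟨ℓ, hℓ, rfl⟩ := Finset.mem_image.1 h
    exact ⟨Finset.mem_range.1 hℓ, rfl⟩
  · rintro ⟨h1, h2⟩
    exact Finset.mem_image.2 ⟨q.1, Finset.mem_range.2 h1, by rw [← h2]⟩

/-- `clauseOf σ` is full. [folklore] -/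
theorem isFullCl_clauseOf (σ : ℕ → Bool) : IsFullCl P.n (clauseOf P σ) := by
  refine ⟨fun q hq => ?_, fun ℓ ⟨h1, h2⟩ => ?_, fun ℓ hℓ => ?_⟩
  · simp only [Finset.mem_product, Finset.mem_range, Finset.mem_univ, and_true]
    exact ((mem_clauseOf P).1 hq).1
  · have e1 := ((mem_clauseOf P).1 h1).2
    have e2 := ((mem_clauseOf P).1 h2).2
    simp only at e1 e2
    rw [← e1] at e2
    exact Bool.noConfusion e2
  · cases hσ : σ ℓ
    · exact Or.inr ((mem_clauseOf P).2 ⟨hℓ, hσ.symm⟩)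
    · exact Or.inl ((mem_clauseOf P).2 ⟨hℓ, hσ.symm⟩)

/-- The literal `x_ℓ^b` is in `clauseOf σ` iff `σ ℓ = b`. [folklore] -/
theorem mem_clauseOf_iff {σ : ℕ → Bool} {ℓ : ℕ} (hℓ : ℓ < P.n) {b : Bool} :
    (ℓ, b) ∈ clauseOf P σ ↔ σ ℓ = b := by
  rw [mem_clauseOf]
  simp only [hℓ, true_and]
  exact ⟨fun h => h.symm, fun h => h.symm⟩

variable (Fc : ℕ → Finset (ℕ × Bool))

open Classical in
/-- A clause index `m` with `C_m ⊆ C` if there is one (`0` otherwise).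
[cite: Garlik2019, Lemma 17 (proof, case 1: "Set I(j,·) to m")] -/
noncomputable def mOf (C : Finset (ℕ × Bool)) : ℕ :=
  if h : ∃ m, m < P.r ∧ Fc m ⊆ C then Nat.find h else 0

/-- Specification of `mOf` on full clauses. [folklore] -/
theorem mOf_spec (hP : CoreHyp P Fc) {C : Finset (ℕ × Bool)} (hC : IsFullCl P.n C) :
    mOf P Fc C < P.r ∧ Fc (mOf P Fc C) ⊆ C := by
  classical
  obtain ⟨m, hm, hsub⟩ := hP.exists_Fc_subset hC
  have h : ∃ m, m < P.r ∧ Fc m ⊆ C := ⟨m, hm, hsub⟩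
  unfold mOf
  rw [dif_pos h]
  exact Nat.find_spec h

/-- The clause forced at a child: `C*[x_0 ↦ 1]` at a left child, `C* = allNeg n` at a right
child. [cite: Garlik2019, Lemma 17 (proof, case 2: filling the children of an RL-vertex)] -/
noncomputable def childClause (K₀ : ℕ) (g : ΩRL P) (i j : ℕ) : Finset (ℕ × Bool) :=
  by classical exact
    if IsLeftChild P K₀ g i j then replaceLit (allNeg P.n) 0 true else allNeg P.n

/-- The child clauses are full (for `n ≥ 1`). [folklore] -/
theorem isFullCl_childClause (hn : 1 ≤ P.n) (K₀ : ℕ) (g : ΩRL P) (i j : ℕ) :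
    IsFullCl P.n (childClause P K₀ g i j) := by
  classical
  unfold childClause
  split_ifs
  · exact isFullCl_replaceLit (isFullCl_allNeg P.n).1 (isFullCl_allNeg P.n).2.1 hn true
      (fun k hk _ => Or.inr (by simp [hk]))
  · exact isFullCl_allNeg P.n

end Clauses

/-! ### The restriction determined by a sample -/

section Rho

variable (P : Params) (Fc : ℕ → Finset (ℕ × Bool)) (K₀ : ℕ)

/-- The effective `D`-selection: selected, not the last pair, and on level `0` not cancelled
by an `I`-selection. [cite: Garlik2019, Def. 9 (A_I ∖ A_D; here the other way round)] -/
def selD' (ω : Ω P) (i j : ℕ) : Prop :=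
  selD P ω.1.1.1 i j = true ∧ ¬ IsLast P i j ∧ (i = 0 → selI P ω.1.2 j = false)

/-- Decidability instance. [folklore] -/
instance (ω : Ω P) (i j : ℕ) : Decidable (selD' P ω i j) :=
  inferInstanceAs (Decidable (_ ∧ _))

/-- **The restriction `ρ(ω)`** [Garlík 2019, Def. 9, with the modifications described in the
module docstring]. [cite: Garlik2019, Def. 9] -/
noncomputable def rho (ω : Ω P) : PA := by
  classical exact
  { D := fun q =>
      if ¬ (q.1 < P.s ∧ q.2 < P.t) then none
      else if 1 ≤ q.1 ∧ q.2 ∈ Kp P K₀ ω.2 q.1 then some (allNeg P.n)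
      else if q.2 ∈ B P K₀ ω.2 q.1 then some (childClause P K₀ ω.2 q.1 q.2)
      else if selD' P ω q.1 q.2 then some (clauseOf P (signs P ω.1.1.1 q.1 q.2))
      else none
    V := fun q =>
      if ¬ (1 ≤ q.1 ∧ q.1 < P.s ∧ q.2 < P.t) then none
      else if q.2 ∈ Kp P K₀ ω.2 q.1 ∨ q.2 ∈ B P K₀ ω.2 q.1 then some 0
      else if selV P ω.1.1.2 q.1 q.2 = true ∧ ¬ IsLast P q.1 q.2 then some (valV P ω.1.1.2 q.1 q.2)
      else if selD' P ω q.1 q.2 then some 0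
      else none
    I := fun j =>
      if ¬ (j < P.t) then none
      else if j ∈ B P K₀ ω.2 0 then some (mOf P Fc (childClause P K₀ ω.2 0 j))
      else if selI P ω.1.2 j = true then some (valI P ω.1.2 j)
      else if selD' P ω 0 j then some (mOf P Fc (clauseOf P (signs P ω.1.1.1 0 j)))
      else none
    L := fun q =>
      if 1 ≤ q.1 ∧ q.1 < P.s ∧ q.2 < P.t ∧ q.2 ∈ Kp P K₀ ω.2 q.1 then some (cL P ω.2 q.1 q.2)
      else none
    R := fun q =>
      if 1 ≤ q.1 ∧ q.1 < P.s ∧ q.2 < P.t ∧ q.2 ∈ Kp P K₀ ω.2 q.1 then some (cR P ω.2 q.1 q.2)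
      else none }

end Rho

variable {P Fc K₀}

/-! #### Reading off the groups of `ρ(ω)` -/

section Read

variable (ω : Ω P)

/-- The `L`-premises of `ρ(ω)`. [folklore] -/
theorem rho_L (q : ℕ × ℕ) : (rho P Fc K₀ ω).L q =
    if 1 ≤ q.1 ∧ q.1 < P.s ∧ q.2 < P.t ∧ q.2 ∈ Kp P K₀ ω.2 q.1 then some (cL P ω.2 q.1 q.2)
    else none := by
  simp only [rho]

/-- The `R`-premises of `ρ(ω)`. [folklore] -/
theorem rho_R (q : ℕ × ℕ) : (rho P Fc K₀ ω).R q =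
    if 1 ≤ q.1 ∧ q.1 < P.s ∧ q.2 < P.t ∧ q.2 ∈ Kp P K₀ ω.2 q.1 then some (cR P ω.2 q.1 q.2)
    else none := by
  simp only [rho]

/-- The clauses of `ρ(ω)`. [folklore] -/
theorem rho_D (q : ℕ × ℕ) : (rho P Fc K₀ ω).D q =
    if ¬ (q.1 < P.s ∧ q.2 < P.t) then none
    else if 1 ≤ q.1 ∧ q.2 ∈ Kp P K₀ ω.2 q.1 then some (allNeg P.n)
    else if q.2 ∈ B P K₀ ω.2 q.1 then some (childClause P K₀ ω.2 q.1 q.2)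
    else if selD' P ω q.1 q.2 then some (clauseOf P (signs P ω.1.1.1 q.1 q.2))
    else none := by
  simp only [rho]

/-- The cut variables of `ρ(ω)`. [folklore] -/
theorem rho_V (q : ℕ × ℕ) : (rho P Fc K₀ ω).V q =
    if ¬ (1 ≤ q.1 ∧ q.1 < P.s ∧ q.2 < P.t) then none
    else if q.2 ∈ Kp P K₀ ω.2 q.1 ∨ q.2 ∈ B P K₀ ω.2 q.1 then some 0
    else if selV P ω.1.1.2 q.1 q.2 = true ∧ ¬ IsLast P q.1 q.2 then some (valV P ω.1.1.2 q.1 q.2)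
    else if selD' P ω q.1 q.2 then some 0
    else none := by
  simp only [rho]

/-- The `F`-clause indices of `ρ(ω)`. [folklore] -/
theorem rho_I (j : ℕ) : (rho P Fc K₀ ω).I j =
    if ¬ (j < P.t) then none
    else if j ∈ B P K₀ ω.2 0 then some (mOf P Fc (childClause P K₀ ω.2 0 j))
    else if selI P ω.1.2 j = true then some (valI P ω.1.2 j)
    else if selD' P ω 0 j then some (mOf P Fc (clauseOf P (signs P ω.1.1.1 0 j)))
    else none := by
  simp only [rho]

variable {ω}

/-- A set `L`-premise is the proposed left child of a kept pair. [folklore] -/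
theorem rho_L_some {i j k : ℕ} (h : (rho P Fc K₀ ω).L (i, j) = some k) :
    1 ≤ i ∧ i < P.s ∧ j < P.t ∧ j ∈ Kp P K₀ ω.2 i ∧ k = cL P ω.2 i j := by
  rw [rho_L] at h
  split_ifs at h with hc
  · simp only [Option.some.injEq] at h
    exact ⟨hc.1, hc.2.1, hc.2.2.1, hc.2.2.2, h.symm⟩

/-- A set `R`-premise is the proposed right child of a kept pair. [folklore] -/
theorem rho_R_some {i j k : ℕ} (h : (rho P Fc K₀ ω).R (i, j) = some k) :
    1 ≤ i ∧ i < P.s ∧ j < P.t ∧ j ∈ Kp P K₀ ω.2 i ∧ k = cR P ω.2 i j := by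
  rw [rho_R] at h
  split_ifs at h with hc
  · simp only [Option.some.injEq] at h
    exact ⟨hc.1, hc.2.1, hc.2.2.1, hc.2.2.2, h.symm⟩

/-- The clause at a kept pair is `C* = allNeg n`. [folklore] -/
theorem rho_D_Kp {i j : ℕ} (h1 : 1 ≤ i) (hi : i < P.s) (hj : j < P.t) (hK : j ∈ Kp P K₀ ω.2 i) :
    (rho P Fc K₀ ω).D (i, j) = some (allNeg P.n) := by
  rw [rho_D]
  simp [hi, hj, h1, hK]

/-- The clause at a child is the child clause. [folklore] -/
theorem rho_D_B {i j : ℕ} (hi : i < P.s) (hj : j < P.t) (hB : j ∈ B P K₀ ω.2 i) :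
    (rho P Fc K₀ ω).D (i, j) = some (childClause P K₀ ω.2 i j) := by
  rw [rho_D]
  have : ¬ (1 ≤ i ∧ j ∈ Kp P K₀ ω.2 i) := fun h => (mem_Kp.1 h.2).2 hB
  simp [hi, hj, this, hB]

/-- The cut variable at a kept pair or a child is `x_0`. [folklore] -/
theorem rho_V_KpB {i j : ℕ} (h1 : 1 ≤ i) (hi : i < P.s) (hj : j < P.t)
    (hK : j ∈ Kp P K₀ ω.2 i ∨ j ∈ B P K₀ ω.2 i) : (rho P Fc K₀ ω).V (i, j) = some 0 := by
  rw [rho_V]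
  simp [hi, hj, h1, hK]

/-- Every clause of `ρ(ω)` is full. [folklore] -/
theorem rho_D_full (hn : 1 ≤ P.n) {i j : ℕ} {C : Finset (ℕ × Bool)}
    (h : (rho P Fc K₀ ω).D (i, j) = some C) : i < P.s ∧ j < P.t ∧ IsFullCl P.n C := by
  rw [rho_D] at h
  simp only at h
  split_ifs at h with hr h1 h2 h3 <;> simp only [Option.some.injEq] at h
  · subst h; exact ⟨hr.1, hr.2, isFullCl_allNeg P.n⟩
  · subst h; exact ⟨hr.1, hr.2, isFullCl_childClause P hn K₀ ω.2 i j⟩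
  · subst h; exact ⟨hr.1, hr.2, isFullCl_clauseOf P _⟩

/-- A set clause comes from one of the three sources. [folklore] -/
theorem rho_D_cases {i j : ℕ} {C : Finset (ℕ × Bool)} (h : (rho P Fc K₀ ω).D (i, j) = some C) :
    i < P.s ∧ j < P.t ∧
      ((1 ≤ i ∧ j ∈ Kp P K₀ ω.2 i ∧ C = allNeg P.n) ∨
       (j ∉ Kp P K₀ ω.2 i ∧ j ∈ B P K₀ ω.2 i ∧ C = childClause P K₀ ω.2 i j) ∨
       (j ∉ Kp P K₀ ω.2 i ∧ j ∉ B P K₀ ω.2 i ∧ selD' P ω i j ∧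
          C = clauseOf P (signs P ω.1.1.1 i j))) := by
  rw [rho_D] at h
  simp only at h
  split_ifs at h with hr h1 h2 h3 <;> simp only [Option.some.injEq] at h
  · exact ⟨hr.1, hr.2, Or.inl ⟨h1.1, h1.2, h.symm⟩⟩
  · have hK : j ∉ Kp P K₀ ω.2 i := fun hK => (mem_Kp.1 hK).2 h2
    exact ⟨hr.1, hr.2, Or.inr (Or.inl ⟨hK, h2, h.symm⟩)⟩
  · have hK : j ∉ Kp P K₀ ω.2 i := by
      intro hK
      rcases Nat.eq_zero_or_pos i with rfl | hipos
      · -- level 0 has no kept pairs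
        have := selRL_spec (selRL_of_mem_S (mem_Kp.1 hK).1)
        omega
      · exact h1 ⟨hipos, hK⟩
    exact ⟨hr.1, hr.2, Or.inr (Or.inr ⟨hK, h2, h3, h.symm⟩)⟩

/-- Level `0` has no kept pairs. [folklore] -/
theorem not_mem_Kp_zero (j : ℕ) : j ∉ Kp P K₀ ω.2 0 := by
  intro hK
  have := selRL_spec (selRL_of_mem_S (mem_Kp.1 hK).1)
  omega

/-- A set cut variable is `x_0` or the proposed one; the pair is in range. [folklore] -/
theorem rho_V_some {i j k : ℕ} (h : (rho P Fc K₀ ω).V (i, j) = some k) :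
    1 ≤ i ∧ i < P.s ∧ j < P.t ∧ (k = 0 ∨ k = valV P ω.1.1.2 i j) := by
  rw [rho_V] at h
  simp only at h
  split_ifs at h with hr h1 h2 h3 <;> simp only [Option.some.injEq] at h
  · exact ⟨hr.1, hr.2.1, hr.2.2, Or.inl h.symm⟩
  · exact ⟨hr.1, hr.2.1, hr.2.2, Or.inr h.symm⟩
  · exact ⟨hr.1, hr.2.1, hr.2.2, Or.inl h.symm⟩

/-- A set `F`-clause index is one of the three; the position is in range. [folklore] -/
theorem rho_I_some {j m : ℕ} (h : (rho P Fc K₀ ω).I j = some m) :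
    j < P.t ∧ ((j ∈ B P K₀ ω.2 0 ∧ m = mOf P Fc (childClause P K₀ ω.2 0 j)) ∨
      (j ∉ B P K₀ ω.2 0 ∧ selI P ω.1.2 j = true ∧ m = valI P ω.1.2 j) ∨
      (j ∉ B P K₀ ω.2 0 ∧ selI P ω.1.2 j = false ∧ selD' P ω 0 j ∧
        m = mOf P Fc (clauseOf P (signs P ω.1.1.1 0 j)))) := by
  rw [rho_I] at h
  split_ifs at h with hr h1 h2 h3 <;> simp only [Option.some.injEq] at h
  · exact ⟨hr, Or.inl ⟨h1, h.symm⟩⟩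
  · exact ⟨hr, Or.inr (Or.inl ⟨h1, h2, h.symm⟩)⟩
  · exact ⟨hr, Or.inr (Or.inr ⟨h1, by simpa using h2, h3, h.symm⟩)⟩

/-- Proposed values are in range. [folklore] -/
theorem valV_lt {v : ΩV P} {i j : ℕ} (hn : 0 < P.n) : valV P v i j < P.n := by
  unfold valV; split_ifs
  · exact Fin.is_lt _
  · exact hn

/-- Proposed values are in range. [folklore] -/
theorem valI_lt {e : ΩI P} {j : ℕ} (hr : 0 < P.r) : valI P e j < P.r := by
  unfold valI; split_ifs
  · exact Fin.is_lt _
  · exact hr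

end Read

/-! #### Admissibility of `ρ(ω)` -/

section Adm

/-- **`ρ(ω)` is admissible, for every sample `ω`** (this replaces [Garlík 2019, Lemma 17]).
[cite: Garlik2019, Lemma 17] -/
theorem admissible_rho (hP : CoreHyp P Fc) (K₀ : ℕ) (ω : Ω P) : Admissible P Fc (rho P Fc K₀ ω) := by
  have hn := hP.one_le_n
  have ht : 0 < P.t := by have := hP.n_lt_s; have := hP.s_le_t; omega
  have hr := hP.one_le_r
  refine ⟨?_, ?_, ?_, ?_, ?_, ?_, ?_, ?_, ?_, ?_, ?_, ?_, ?_, ?_, ?_, ?_, ?_, ?_, ?_, ?_, ?_⟩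
  · -- D_range
    intro i j C h
    obtain ⟨hi, hj, hf⟩ := rho_D_full hn h
    exact ⟨hi, hj, hf.1⟩
  · -- V_range
    intro i j k h
    obtain ⟨h1, hi, hj, hk⟩ := rho_V_some h
    refine ⟨h1, hi, hj, ?_⟩
    rcases hk with rfl | rfl
    · exact hn
    · exact valV_lt hn
  · -- I_range
    intro j k h
    obtain ⟨hj, hk⟩ := rho_I_some h
    refine ⟨hj, ?_⟩
    rcases hk with ⟨-, rfl⟩ | ⟨-, -, rfl⟩ | ⟨-, -, -, rfl⟩
    · exact (mOf_spec P Fc hP (isFullCl_childClause P hn K₀ ω.2 0 j)).1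
    · exact valI_lt hr
    · exact (mOf_spec P Fc hP (isFullCl_clauseOf P _)).1
  · -- L_range
    intro i j k h
    obtain ⟨h1, hi, hj, -, rfl⟩ := rho_L_some h
    exact ⟨h1, hi, hj, cL_lt ht⟩
  · -- R_range
    intro i j k h
    obtain ⟨h1, hi, hj, -, rfl⟩ := rho_R_some h
    exact ⟨h1, hi, hj, cR_lt ht⟩
  · -- L_D
    intro p j k h
    obtain ⟨h1, hi, hj, hK, rfl⟩ := rho_L_some h
    refine ⟨by rw [rho_D_Kp h1 hi hj hK]; simp, ?_⟩
    rw [rho_D_B (by omega) (cL_lt ht) (cL_mem_B (mem_Kp.1 hK).1)]; simp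
  · -- R_D
    intro p j k h
    obtain ⟨h1, hi, hj, hK, rfl⟩ := rho_R_some h
    refine ⟨by rw [rho_D_Kp h1 hi hj hK]; simp, ?_⟩
    rw [rho_D_B (by omega) (cR_lt ht) (cR_mem_B (mem_Kp.1 hK).1)]; simp
  · -- D_V
    intro p j h
    obtain ⟨C, hC⟩ := Option.ne_none_iff_exists'.1 h
    obtain ⟨hi, hj, hcases⟩ := rho_D_cases hC
    rcases hcases with ⟨-, hK, -⟩ | ⟨-, hB, -⟩ | ⟨hK, hB, hsel, -⟩
    · rw [rho_V_KpB (by omega) hi hj (Or.inl hK)]; simp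
    · rw [rho_V_KpB (by omega) hi hj (Or.inr hB)]; simp
    · have hr : (1 ≤ p + 1 ∧ p + 1 < P.s ∧ j < P.t) := ⟨by omega, hi, hj⟩
      rw [rho_V, if_neg (not_not.2 hr), if_neg (not_or.2 ⟨hK, hB⟩)]
      by_cases h2 : selV P ω.1.1.2 (p + 1) j = true ∧ ¬ IsLast P (p + 1) j
      · rw [if_pos h2]; simp
      · rw [if_neg h2, if_pos hsel]; simp
  · -- D_I
    intro j h
    obtain ⟨C, hC⟩ := Option.ne_none_iff_exists'.1 h
    obtain ⟨-, hj, hcases⟩ := rho_D_cases hC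
    rcases hcases with ⟨h0, -, -⟩ | ⟨-, hB, -⟩ | ⟨-, hB, hsel, -⟩
    · omega
    · rw [rho_I, if_neg (not_not.2 hj), if_pos hB]; simp
    · rw [rho_I, if_neg (not_not.2 hj), if_neg hB]
      by_cases h2 : selI P ω.1.2 j = true
      · rw [if_pos h2]; simp
      · rw [if_neg h2, if_pos hsel]; simp
  · -- D_nonTaut
    intro i j C h ℓ
    exact (rho_D_full hn h).2.2.2.1 ℓ
  · -- D_card
    intro i j C h hlt
    rw [(rho_D_full hn h).2.2.card_eq] at hlt; exact absurd hlt (lt_irrefl _)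
  · -- D_cut
    intro i j C k h hlt _
    rw [(rho_D_full hn h).2.2.card_eq] at hlt; exact absurd hlt (lt_irrefl _)
  · -- D_last
    intro i j C hi hj h
    obtain ⟨-, -, hcases⟩ := rho_D_cases h
    rcases hcases with ⟨-, hK, -⟩ | ⟨-, hB, -⟩ | ⟨-, -, hsel, -⟩
    · exact absurd ⟨hi, hj⟩ (selRL_spec (selRL_of_mem_S (mem_Kp.1 hK).1)).2.2.2
    · have := lt_of_mem_B hB; omega
    · exact absurd ⟨hi, hj⟩ hsel.2.1
  · -- D_F
    intro j C m hD hI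
    obtain ⟨-, hj, hcases⟩ := rho_D_cases hD
    obtain ⟨-, hIc⟩ := rho_I_some hI
    rcases hcases with ⟨h0, -, -⟩ | ⟨-, hB, rfl⟩ | ⟨-, hB, hsel, rfl⟩
    · omega
    · rcases hIc with ⟨-, rfl⟩ | ⟨hB', -, -⟩ | ⟨hB', -, -, -⟩
      · exact (mOf_spec P Fc hP (isFullCl_childClause P hn K₀ ω.2 0 j)).2
      · exact absurd hB hB'
      · exact absurd hB hB'
    · rcases hIc with ⟨hB', -⟩ | ⟨-, hsI, -⟩ | ⟨-, -, -, rfl⟩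
      · exact absurd hB' hB
      · have := hsel.2.2 rfl; rw [this] at hsI; exact absurd hsI (by simp)
      · exact (mOf_spec P Fc hP (isFullCl_clauseOf P _)).2
  · -- L_cut
    intro p j k ℓ C' hL hV hD
    obtain ⟨h1, hi, hj, hK, rfl⟩ := rho_L_some hL
    have hS := (mem_Kp.1 hK).1
    rw [rho_V_KpB h1 hi hj (Or.inl hK)] at hV
    simp only [Option.some.injEq] at hV
    subst hV
    rw [rho_D_B (by omega) (cL_lt ht) (cL_mem_B hS)] at hD
    simp only [Option.some.injEq] at hD
    subst hD
    classical
    unfold childClause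
    rw [if_pos ⟨j, hS, rfl⟩]
    exact mem_replaceLit_self _ _ _
  · -- R_cut
    intro p j k ℓ C' hR hV hD
    obtain ⟨h1, hi, hj, hK, rfl⟩ := rho_R_some hR
    have hS := (mem_Kp.1 hK).1
    rw [rho_V_KpB h1 hi hj (Or.inl hK)] at hV
    simp only [Option.some.injEq] at hV
    subst hV
    rw [rho_D_B (by omega) (cR_lt ht) (cR_mem_B hS)] at hD
    simp only [Option.some.injEq] at hD
    subst hD
    classical
    unfold childClause
    rw [if_neg (not_isLeftChild_cR hS)]
    simp only [mem_allNeg, and_true]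
    exact hn
  · -- L_keep
    intro p j k ℓ C C' hL hV hDp hD
    obtain ⟨h1, hi, hj, hK, rfl⟩ := rho_L_some hL
    have hS := (mem_Kp.1 hK).1
    rw [rho_D_Kp h1 hi hj hK] at hDp
    simp only [Option.some.injEq] at hDp
    subst hDp
    rw [rho_D_B (by omega) (cL_lt ht) (cL_mem_B hS)] at hD
    simp only [Option.some.injEq] at hD
    subst hD
    intro q hq _
    classical
    unfold childClause at hq
    split_ifs at hq
    · rcases mem_replaceLit.1 hq with rfl | ⟨hq', -⟩
      · rw [rho_V_KpB h1 hi hj (Or.inl hK)] at hV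
        simp only [Option.some.injEq] at hV
        subst hV
        exact absurd rfl ‹(0, true) ≠ ((0 : ℕ), true)›
      · exact hq'
    · exact hq
  · -- R_keep
    intro p j k ℓ C C' hR hV hDp hD
    obtain ⟨h1, hi, hj, hK, rfl⟩ := rho_R_some hR
    have hS := (mem_Kp.1 hK).1
    rw [rho_D_Kp h1 hi hj hK] at hDp
    simp only [Option.some.injEq] at hDp
    subst hDp
    rw [rho_D_B (by omega) (cR_lt ht) (cR_mem_B hS)] at hD
    simp only [Option.some.injEq] at hD
    subst hD
    intro q hq _
    classical
    unfold childClause at hq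
    rw [if_neg (not_isLeftChild_cR hS)] at hq
    exact hq
  · -- inj_LL
    intro i j₁ j₂ k h1 h2
    obtain ⟨-, -, -, hK₁, rfl⟩ := rho_L_some h1
    obtain ⟨-, -, -, hK₂, he⟩ := rho_L_some h2
    by_contra hne
    exact (children_disjoint (mem_Kp.1 hK₁).1 (mem_Kp.1 hK₂).1 hne).1 he
  · -- inj_RR
    intro i j₁ j₂ k h1 h2
    obtain ⟨-, -, -, hK₁, rfl⟩ := rho_R_some h1
    obtain ⟨-, -, -, hK₂, he⟩ := rho_R_some h2
    by_contra hne
    exact (children_disjoint (mem_Kp.1 hK₁).1 (mem_Kp.1 hK₂).1 hne).2.2.2 he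
  · -- inj_LR
    intro i j₁ j₂ k h1 h2
    obtain ⟨-, -, -, hK₁, rfl⟩ := rho_L_some h1
    obtain ⟨-, -, -, hK₂, he⟩ := rho_R_some h2
    by_cases hj : j₁ = j₂
    · subst hj; exact cL_ne_cR (mem_Kp.1 hK₁).1 he
    · exact (children_disjoint (mem_Kp.1 hK₁).1 (mem_Kp.1 hK₂).1 hj).2.1 he

end Adm

/-! #### Sparsity of `ρ(ω)` -/

section Sparse

/-- The `D`-selected positions of level `i`. [cite: Garlik2019, Lemma 10 (i)] -/
def selDSet (P : Params) (d : ΩD P) (i : ℕ) : Finset ℕ :=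
  (Finset.range P.t).filter fun j => selD P d i j = true

/-- The `V`-selected positions of level `i`. [cite: Garlik2019, Lemma 10 (ii)] -/
def selVSet (P : Params) (v : ΩV P) (i : ℕ) : Finset ℕ :=
  (Finset.range P.t).filter fun j => selV P v i j = true

/-- The `I`-selected positions. [cite: Garlik2019, Lemma 10 (iii)] -/
def selISet (P : Params) (e : ΩI P) : Finset ℕ :=
  (Finset.range P.t).filter fun j => selI P e j = true

/-- The level counts are small: at most `K₀` `D`-, `V`- and `I`-selections per level (the
good event of [Garlík 2019, Lemma 10]; the `RL`-count is capped by construction).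
[cite: Garlik2019, Lemma 10] -/
structure SmallCounts (P : Params) (K₀ : ℕ) (ω : Ω P) : Prop where
  /-- (i) -/
  D : ∀ i, (selDSet P ω.1.1.1 i).card ≤ K₀
  /-- (ii), the `V` part -/
  V : ∀ i, (selVSet P ω.1.1.2 i).card ≤ K₀
  /-- (iii) -/
  I : (selISet P ω.1.2).card ≤ K₀

/-- **Sparsity** [Garlík 2019, Lemma 10]: under `SmallCounts`, `ρ(ω)` sets groups at at most
`6K₀` pairs per level. [cite: Garlik2019, Lemma 10] -/
theorem levelSparse_rho {ω : Ω P} (hc : SmallCounts P K₀ ω) : LevelSparse P (6 * K₀) (rho P Fc K₀ ω) := by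
  classical
  intro i
  have hsub : setPairs P (rho P Fc K₀ ω) i ⊆ Kp P K₀ ω.2 i ∪ B P K₀ ω.2 i ∪ selDSet P ω.1.1.1 i ∪
      selVSet P ω.1.1.2 i ∪ selISet P ω.1.2 := by
    intro j hj
    simp only [setPairs, Finset.mem_filter, Finset.mem_range] at hj
    obtain ⟨hjt, hset⟩ := hj
    simp only [Finset.mem_union, selDSet, selVSet, selISet, Finset.mem_filter, Finset.mem_range]
    rcases hset with h | h | h | h | ⟨rfl, h⟩
    · obtain ⟨C, hC⟩ := Option.ne_none_iff_exists'.1 h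
      obtain ⟨-, -, hcases⟩ := rho_D_cases hC
      rcases hcases with ⟨-, hK, -⟩ | ⟨-, hB, -⟩ | ⟨-, -, hsel, -⟩
      · exact Or.inl (Or.inl (Or.inl (Or.inl hK)))
      · exact Or.inl (Or.inl (Or.inl (Or.inr hB)))
      · exact Or.inl (Or.inl (Or.inr ⟨hjt, hsel.1⟩))
    · obtain ⟨k, hk⟩ := Option.ne_none_iff_exists'.1 h
      rw [rho_V] at hk
      simp only at hk
      split_ifs at hk with hr h1 h2 h3
      · rcases h1 with h1 | h1
        · exact Or.inl (Or.inl (Or.inl (Or.inl h1)))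
        · exact Or.inl (Or.inl (Or.inl (Or.inr h1)))
      · exact Or.inl (Or.inr ⟨hjt, h2.1⟩)
      · exact Or.inl (Or.inl (Or.inr ⟨hjt, h3.1⟩))
    · obtain ⟨-, -, -, hK, -⟩ := rho_L_some (Option.ne_none_iff_exists'.1 h).choose_spec
      exact Or.inl (Or.inl (Or.inl (Or.inl hK)))
    · obtain ⟨-, -, -, hK, -⟩ := rho_R_some (Option.ne_none_iff_exists'.1 h).choose_spec
      exact Or.inl (Or.inl (Or.inl (Or.inl hK)))
    · obtain ⟨m, hm⟩ := Option.ne_none_iff_exists'.1 h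
      obtain ⟨-, hcases⟩ := rho_I_some hm
      rcases hcases with ⟨hB, -⟩ | ⟨-, hsI, -⟩ | ⟨-, -, hsel, -⟩
      · exact Or.inl (Or.inl (Or.inl (Or.inr hB)))
      · exact Or.inr ⟨hjt, hsI⟩
      · exact Or.inl (Or.inl (Or.inr ⟨hjt, hsel.1⟩))
  calc (setPairs P (rho P Fc K₀ ω) i).card
      ≤ (Kp P K₀ ω.2 i ∪ B P K₀ ω.2 i ∪ selDSet P ω.1.1.1 i ∪ selVSet P ω.1.1.2 i ∪
          selISet P ω.1.2).card := Finset.card_le_card hsub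
    _ ≤ (Kp P K₀ ω.2 i).card + (B P K₀ ω.2 i).card + (selDSet P ω.1.1.1 i).card +
          (selVSet P ω.1.1.2 i).card + (selISet P ω.1.2).card := by
        refine (Finset.card_union_le _ _).trans ?_
        gcongr
        refine (Finset.card_union_le _ _).trans ?_
        gcongr
        refine (Finset.card_union_le _ _).trans ?_
        gcongr
        exact Finset.card_union_le _ _
    _ ≤ K₀ + 2 * K₀ + K₀ + K₀ + K₀ := by
        gcongr
        · exact card_Kp_le K₀ ω.2 i
        · exact card_B_le K₀ ω.2 i
        · exact hc.D i
        · exact hc.V i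
        · exact hc.I
    _ = 6 * K₀ := by ring

end Sparse


end LevelledRefCNF

end Literature.Computability.MetaComplexity
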